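import Summits.ResolutionOfSingularities.ResolutionOfSingularities.Theorems.PurelyInseparableDim4ChartAtlasSNCFarRepairReadingLocus
import Summits.ResolutionOfSingularities.ResolutionOfSingularities.Theorems.PurelyInseparableDim4ChartAtlasSNCFarRepairReadingMembers
import Summits.ResolutionOfSingularities.ResolutionOfSingularities.Theorems.PurelyInseparableDim4ChartAtlasSNCLocalBase
import Summits.ResolutionOfSingularities.ResolutionOfSingularities.Theorems.PurelyInseparableDim4ChartAtlasSNCManyHeights
import Literature.AlgebraicGeometry.Resolution.TransformCompDisjoint
import HarnessLib

/-!
# Purely inseparable four-folds `z^p + F(x₁, …, x₄)`: THE READING OF THE ESCAPING CENTRE AFTER THE FAR-RESONANCE REPAIR AT ANY FINITE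
# NUMBER OF HEIGHTS (chart model; cell `res-dim4-pi`, typ-2 g8; HANDOFF g7 OPEN 4 «post-repair readings» for the one-step repair of p718376 /
# `farSide_globalCentre_pairs_every` p721332, whose output `hs` is an arbitrary nodup list of collision heights)

[OURS · counted 0] (D-0157 DOOR 2; DR-157-C.) Setting of p718376: `j ∉ T`, `F` `T`-permissible, `hs ≠ []` nodup heights, `C(hs) = Π_{h ∈ hs} C_h`,
`C_h = ψ_{−h}^*𝓘(V(y_0, y_T, y_j))`, `τ : V′ → 𝔸⁵` ANY blowing up along `C(hs)`. PROVED here (no `sorry`, no new axiom), by induction on `hs`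
(Literature `IsBlowup.exists_comp_eq_of_mul`: `τ = τ₂ ≫ τ₁`, `τ₁` along `C_h`, `τ₂` along `τ₁^*C(hs′)`; Literature `TransformCompDisjoint`:
strict / controlled transforms along the composite are the iterated ones for disjoint centres; p723027 `farRepair_chart_reading` for `τ₁`;
p718958's restriction of `τ₂` over the chart; `comap_chart_heightLoci` (`…ReadingLocus`): on that chart `τ₁^*C(hs′)` is `C(hs′ − h)`;
induction on the number of heights):

* `foldl_heightStates_shift` — the height/state fold is equivariant under shifting all heights;
* **`farRepair_chart_reading_heights`** (and `…_aux`, the same with the number of heights as a parameter) — there is an OPEN IMMERSION `φ : 𝔸⁵ → V′` such that: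
  (1) `St_τ(V(y_0, y_T))` reads `V(y_0, y_T)` and (2) lies inside `φ(𝔸⁵)` — after the whole repair the strict transform of the escaping
  centre is STILL a single-chart coordinate centre;
  (3) the controlled transform of `(z^p + F)·𝒪` reads `(z^p + F⁽ʰˢ⁾)·𝒪`, where `(h_last, F⁽ʰˢ⁾)` is the FOLD over `hs` of
  `(h_prev, G) ↦ (h, (CentreBlowup.step p (insert j T) j 0 ⟨G(y_j + (h − h_prev)), 0, ∅⟩).F)` from `(0, F)` — one coordinate-centre STEP of the
  tree per height, each in the frame translated by the difference of consecutive heights; (4) `T` is permissible for `F⁽ʰˢ⁾`;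
  (5) the exceptional ideal `τ^*C(hs)` reads `Π_{h ∈ hs} (y_j + (h_last − h))·𝒪` (parallel hyperplanes, the last one `y_j·𝒪`);
  (6) an index-`j` hyperplane `(y_j + a)·𝒪` reads `⊤` if `−a ∈ hs` (it was at a repaired height) and `(y_j + (a + h_last))·𝒪` otherwise;
  (7) a near member `y_t·𝒪`, `t ∈ T`, reads `y_t·𝒪`; (8) a transversal member `(yᵢ + a)·𝒪`, `i ∉ T ∪ {j}`, reads itself.

Far quadrics after a many-heights repair have readings of degree `|hs| + 2` (one height: p723327); they are not listed here. Nothing here is a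
statement about resolution of singularities in dimension ≥ 4 / characteristic `p` (NOT proved anywhere in this programme).
bears_on: LADDER-RESOLUTION:D157-DOOR2 (res-dim4-pi). Supports stmt-ResolutionOfSingularities-16155 (helper).
-/

-- every declaration of this summit lives under `Summit.ResolutionOfSingularities.ResolutionOfSingularities`
-- (summit = problem), which the duplicate-namespace linter flags; house convention (cf. the Target file).
set_option linter.dupNamespace false

noncomputable section

open MvPolynomial CategoryTheory AlgebraicGeometry TopologicalSpace
open AlgebraicGeometry.Scheme.IdealSheafData (ofIdealTop)

namespace Summit.ResolutionOfSingularities.ResolutionOfSingularities.Theorems.PIDim4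

open Literature.AlgebraicGeometry.Resolution
open Literature.AlgebraicGeometry.Resolution.Hauser2010
open Literature.AlgebraicGeometry.Resolution.AffinePointBlowup (P A γ coord)

namespace ChartDictionary

/-! ## §1 The height/state fold under a shift of all heights -/

section Fold

variable {K : Type} [Field K] {α : Type*}

/-- **Shifting every height by `c` shifts the recorded height and leaves the states alone** (the fold only sees differences of heights). -/
theorem foldl_heightStates_shift (f : K → α → α) (l : List K) (a c : K) (x : α) :
    (l.map fun h => h - c).foldl (fun (acc : K × α) (h : K) => (h, f (h - acc.1) acc.2)) (a - c, x) =
      ((l.foldl (fun (acc : K × α) (h : K) => (h, f (h - acc.1) acc.2)) (a, x)).1 - c,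
        (l.foldl (fun (acc : K × α) (h : K) => (h, f (h - acc.1) acc.2)) (a, x)).2) := by
  induction l generalizing a x with
  | nil => rfl
  | cons h l ih =>
    rw [List.map_cons, List.foldl_cons, List.foldl_cons]
    have e : h - c - (a - c) = h - a := sub_sub_sub_cancel_right h a c
    rw [show ((h - c, f (h - c - (a - c, x).1) (a - c, x).2) : K × α) = (h - c, f (h - (a, x).1) (a, x).2) by rw [e]]
    exact ih h (f (h - a) x)

end Fold

/-! ## §2 The reading after the repair at any finite number of heights -/

section Heights

variable {K : Type} [Field K] {p : ℕ} [hp : Fact p.Prime] [CharP K p] {T : Finset (Fin 4)} {j : Fin 4}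

/-- `farRepair_chart_reading_heights` by induction on the number of heights (auxiliary form with the length as a parameter). -/
theorem farRepair_chart_reading_heights_aux [PerfectRing K p] [DecidableEq K] (hjT : j ∉ T) (n : ℕ) :
    ∀ (hs : List K), hs.length = n → hs ≠ [] → hs.Nodup → ∀ (F : MvPolynomial (Fin 4) K), (p : ℕ∞) ≤ CentreBlowup.ordAlong T F →
    ∀ {V' : Scheme.{0}} {τ : V' ⟶ P 4 K},
    IsBlowup τ (hs.map fun h => (AffineCoordBlowup.𝓘Λ 4 K (insert 0 (Fin.succ '' ((insert j T : Finset (Fin 4)) : Set (Fin 4))))).comap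
      (Spec.map (CommRingCat.ofHom ((AffinePointBlowup.translateEquiv (n := 4) (Pi.single j.succ (-h)) : A 4 K ≃ₐ[K] A 4 K) :
        A 4 K →+* A 4 K)))).prod →
    let Cm := (hs.map fun h => (AffineCoordBlowup.𝓘Λ 4 K (insert 0 (Fin.succ '' ((insert j T : Finset (Fin 4)) : Set (Fin 4))))).comap
      (Spec.map (CommRingCat.ofHom ((AffinePointBlowup.translateEquiv (n := 4) (Pi.single j.succ (-h)) : A 4 K ≃ₐ[K] A 4 K) :
        A 4 K →+* A 4 K)))).prod
    let out := hs.foldl (fun (acc : K × MvPolynomial (Fin 4) K) (h : K) =>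
      (h, (CentreBlowup.step p (insert j T) j 0 ⟨PointBlowup.translate (Pi.single j (h - acc.1)) acc.2, 0, ∅⟩).F)) (0, F)
    ∃ (φ : P 4 K ⟶ V') (_ : IsOpenImmersion φ),
      (strictTransformIdeal τ Cm (AffineCoordBlowup.𝓘Λ 4 K (insert 0 (Fin.succ '' (T : Set (Fin 4)))))).comap φ =
          AffineCoordBlowup.𝓘Λ 4 K (insert 0 (Fin.succ '' (T : Set (Fin 4)))) ∧
        ((strictTransformIdeal τ Cm (AffineCoordBlowup.𝓘Λ 4 K (insert 0 (Fin.succ '' (T : Set (Fin 4)))))).support : Set V') ⊆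
          Set.range φ ∧
        (controlledTransform τ Cm (hypSheaf p F) p).comap φ = hypSheaf p out.2 ∧
        (p : ℕ∞) ≤ CentreBlowup.ordAlong T out.2 ∧
        (Cm.comap τ).comap φ = (hs.map fun h => ofIdealTop (Ideal.span {(γ 4 K).symm (X j.succ + C (out.1 - h))})).prod ∧
        (∀ a : K, (strictTransformIdeal τ Cm (ofIdealTop (Ideal.span {(γ 4 K).symm (X j.succ + C a)}))).comap φ =
          if -a ∈ hs then ⊤ else ofIdealTop (Ideal.span {(γ 4 K).symm (X j.succ + C (a + out.1))})) ∧
        (∀ t ∈ T, (strictTransformIdeal τ Cm (ofIdealTop (Ideal.span {(γ 4 K).symm (X t.succ + C 0)}))).comap φ =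
          ofIdealTop (Ideal.span {(γ 4 K).symm (X t.succ + C 0)})) ∧
        (∀ i ∉ T, i ≠ j → ∀ a : K, (strictTransformIdeal τ Cm (ofIdealTop (Ideal.span {(γ 4 K).symm (X i.succ + C a)}))).comap φ =
          ofIdealTop (Ideal.span {(γ 4 K).symm (X i.succ + C a)})) := by
  induction n with
  | zero => intro hs hlen hne; exact absurd (List.eq_nil_of_length_eq_zero hlen) hne
  | succ n ih =>
    intro hs hlen _ hnd F hperm V' τ hτ
    obtain _ | ⟨h, hs'⟩ := hs
    · exact absurd hlen (by simp)
    rw [List.length_cons, Nat.succ_inj] at hlen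
    obtain ⟨hnh, hnd'⟩ := List.nodup_cons.mp hnd
    -- the one-height reading for the first factor
    have hs₁ : (⟨PointBlowup.translate (Pi.single j (h - 0)) F, 0, ∅⟩ : State K).F = PointBlowup.translate (Pi.single j h) F := by
      rw [sub_zero]
    simp only [List.map_cons, List.prod_cons, List.foldl_cons] at hτ ⊢
    by_cases hnil : hs' = []
    · -- ONE HEIGHT: p723027 + p723327
      subst hnil
      simp only [List.map_nil, List.prod_nil, mul_one, List.foldl_nil] at hτ ⊢
      obtain ⟨Θ, g, hiso, h0, hs, hg, h1, h2, h3, h4, h5⟩ := farRepair_chart_reading hjT h F hperm _ hs₁ hτ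
      haveI := hiso
      refine ⟨Spec.map (CommRingCat.ofHom (Θ : A 4 K →+* A 4 K)) ≫
        AffineCoordBlowup.chartImm (isBlowup_comp_spec_translate hτ) (succ_mem_centreVars (Finset.mem_insert_self j T)),
        inferInstance, h1, h2, h3, h5, ?_, fun a => ?_, fun t ht => ?_, fun i hiT hij a => ?_⟩
      · rw [h4, sub_self]
      · by_cases ha : -a = h
        · have ha' : a + h = 0 := by rw [← ha, add_neg_cancel]
          rw [if_pos (List.mem_singleton.mpr ha), Scheme.IdealSheafData.comap_comp, strictTransform_hyperplane_j_height_self hτ ha',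
            Scheme.IdealSheafData.comap_top]
        · have ha' : a + h ≠ 0 := fun e => ha (by rw [← neg_eq_iff_add_eq_zero] at e; exact e.symm ▸ rfl)
          rw [if_neg (fun hm => ha (List.mem_singleton.mp hm)), Scheme.IdealSheafData.comap_comp,
            strictTransform_hyperplane_j_height_of_ne hτ ha']
          exact comap_specMap_principal_of_fix Θ (by rw [map_add, hs j, show Θ (C (a + h)) = C (a + h) from Θ.commutes _])
      · rw [Scheme.IdealSheafData.comap_comp, strictTransform_hyperplane_centreVar_height hτ ht hjT]
        exact comap_specMap_principal_of_fix Θ (by rw [map_add, hs t, show Θ (C (0 : K)) = C 0 from Θ.commutes _])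
      · rw [Scheme.IdealSheafData.comap_comp, strictTransform_hyperplane_transversal_height hτ hiT hij a]
        exact comap_specMap_principal_of_fix Θ (by rw [map_add, hs i, show Θ (C a) = C a from Θ.commutes _])
    · -- SEVERAL HEIGHTS: factor, read the first repair, restrict the rest over its chart, induct
      set Λ : Set (Fin (4 + 1)) := insert 0 (Fin.succ '' ((insert j T : Finset (Fin 4)) : Set (Fin 4))) with hΛ
      set Cf : K → Scheme.IdealSheafData (P 4 K) := fun h => (AffineCoordBlowup.𝓘Λ 4 K Λ).comap
        (Spec.map (CommRingCat.ofHom ((AffinePointBlowup.translateEquiv (n := 4) (Pi.single j.succ (-h)) : A 4 K ≃ₐ[K] A 4 K) :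
          A 4 K →+* A 4 K))) with hCf
      have hdisj : Disjoint ((Cf h).support : Set (P 4 K)) ((hs'.map Cf).prod.support : Set (P 4 K)) := disjoint_support_heights hnh
      -- factor `τ = τ₂ ≫ τ₁`
      obtain ⟨X₁, τ₁, τ₂, hτ₁, hτ₂, rfl⟩ := hτ.exists_comp_eq_of_mul
      haveI : IsLocallyNoetherian X₁ := hτ₁.isLocallyNoetherian
      haveI : IsLocallyNoetherian V' := hτ₂.isLocallyNoetherian
      -- the first repair, read on its chart
      obtain ⟨Θ, g, hiso, h0, hs, hg, h1, h2, h3, h4, h5⟩ := farRepair_chart_reading hjT h F hperm _ hs₁ hτ₁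
      haveI := hiso
      set φ₁ := Spec.map (CommRingCat.ofHom (Θ : A 4 K →+* A 4 K)) ≫
        AffineCoordBlowup.chartImm (isBlowup_comp_spec_translate hτ₁) (succ_mem_centreVars (Finset.mem_insert_self j T)) with hφ₁
      haveI : IsOpenImmersion φ₁ := inferInstanceAs (IsOpenImmersion (Spec.map (CommRingCat.ofHom (Θ : A 4 K →+* A 4 K)) ≫
        AffineCoordBlowup.chartImm (isBlowup_comp_spec_translate hτ₁) (succ_mem_centreVars (Finset.mem_insert_self j T))))
      -- the remaining centre on that chart: the shifted heights
      have hX : (((hs'.map Cf).prod).comap τ₁).comap φ₁ = ((hs'.map fun h' => h' - h).map Cf).prod := by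
        rw [hφ₁, hCf]
        exact comap_chart_heightLoci hjT h0 hs hg hnh hτ₁
      -- the rest of the repair, restricted over the chart, is the same repair at the shifted heights
      have hτ₂' := isBlowup_morphismRestrict_comp_isoOpensRange_inv φ₁ hτ₂
      rw [hX] at hτ₂'
      have hne' : (hs'.map fun h' => h' - h) ≠ [] := fun e => hnil (List.map_eq_nil_iff.mp e)
      have hnd'' : (hs'.map fun h' => h' - h).Nodup := hnd'.map (sub_left_injective)
      obtain ⟨φ₂, hφ₂, g1, g2, g3, g4, g5, g6, g7, g8⟩ := ih _ (by rw [List.length_map, hlen]) hne' hnd'' _ h5 hτ₂'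
      -- the fold at the shifted heights
      have hfold := foldl_heightStates_shift (α := MvPolynomial (Fin 4) K)
        (fun (d : K) (G : MvPolynomial (Fin 4) K) => (CentreBlowup.step p (insert j T) j 0 ⟨PointBlowup.translate (Pi.single j d) G, 0, ∅⟩).F)
        hs' h h (CentreBlowup.step p (insert j T) j 0 ⟨PointBlowup.translate (Pi.single j (h - 0)) F, 0, ∅⟩).F
      rw [sub_self] at hfold
      simp only [hfold] at g3 g4 g5 g6
      -- the chart of the repaired centre after the whole repair
      refine ⟨φ₂ ≫ (τ₂ ⁻¹ᵁ φ₁.opensRange).ι, inferInstance, ?_, ?_, ?_, g4, ?_, fun a => ?_, fun t ht => ?_, fun i hiT hij a => ?_⟩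
      · -- (1) the strict transform of the escaping centre
        rw [IsBlowup.strictTransformIdeal_comp_of_disjoint hτ₂ hdisj, Scheme.IdealSheafData.comap_comp, ← strictTransformIdeal_model φ₁, hX,
          h1]
        exact g1
      · -- (2) single chart
        intro x hx
        rw [IsBlowup.strictTransformIdeal_comp_of_disjoint hτ₂ hdisj] at hx
        have hx₁ : τ₂ x ∈ φ₁.opensRange := by
          have h' := h2 (mem_support_of_mem_support_strictTransformIdeal hx)
          rwa [← Scheme.Hom.coe_opensRange] at h'
        obtain ⟨x', rfl⟩ : x ∈ Set.range (τ₂ ⁻¹ᵁ φ₁.opensRange).ι := by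
          rw [Scheme.Opens.range_ι]
          exact hx₁
        have hx' : x' ∈ ((strictTransformIdeal ((τ₂ ∣_ φ₁.opensRange) ≫ φ₁.isoOpensRange.inv) (((hs'.map Cf).prod.comap τ₁).comap φ₁)
            ((strictTransformIdeal τ₁ (Cf h) (AffineCoordBlowup.𝓘Λ 4 K (insert 0 (Fin.succ '' (T : Set (Fin 4)))))).comap φ₁)).support :
            Set _) := by
          rw [strictTransformIdeal_model φ₁]
          exact (mem_support_comap_iff _ _ x').mpr hx
        rw [hX, h1] at hx'
        obtain ⟨y, rfl⟩ := g2 hx'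
        exact ⟨y, rfl⟩
      · -- (3) the controlled transform
        rw [IsBlowup.controlledTransform_comp_of_disjoint hτ₁ hτ₂ hdisj, Scheme.IdealSheafData.comap_comp, ← controlledTransform_model φ₁, hX, h3]
        exact g3
      · -- (5) the exceptional ideal
        rw [comap_mul_comp, comap_mul]
        congr 1
        · rw [← IsBlowup.strictTransformIdeal_comap_fst_of_disjoint hτ₂ hdisj, Scheme.IdealSheafData.comap_comp, ← strictTransformIdeal_model φ₁,
            hX, h4, g6 0]
          have h0ni : ¬ (-(0 : K)) ∈ hs'.map (fun h' => h' - h) := by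
            rw [neg_zero, List.mem_map]
            rintro ⟨h', hh', e⟩
            exact hnh (sub_eq_zero.mp e ▸ hh')
          rw [if_neg h0ni, zero_add]
        · rw [Scheme.IdealSheafData.comap_comp, ← comap_centre_model φ₁, hX, g5, List.map_map]
          congr 1
          refine List.map_congr_left fun h' _ => ?_
          simp only [Function.comp_apply, sub_sub_sub_cancel_right]
      · -- (6) index-`j` hyperplanes
        rw [IsBlowup.strictTransformIdeal_comp_of_disjoint hτ₂ hdisj, Scheme.IdealSheafData.comap_comp, ← strictTransformIdeal_model φ₁, hX]
        by_cases ha : a + h = 0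
        · have ham : -a ∈ h :: hs' := List.mem_cons.mpr (Or.inl (neg_eq_of_add_eq_zero_left ((add_comm h a).trans ha)))
          have e6 : (strictTransformIdeal τ₁ (Cf h) (ofIdealTop (Ideal.span {(γ 4 K).symm (X j.succ + C a)}))).comap φ₁ = ⊤ := by
            rw [hφ₁, Scheme.IdealSheafData.comap_comp, hCf, strictTransform_hyperplane_j_height_self hτ₁ ha, Scheme.IdealSheafData.comap_top]
          rw [if_pos ham, e6, strictTransformIdeal_top, Scheme.IdealSheafData.comap_top]
        · have e6 : (strictTransformIdeal τ₁ (Cf h) (ofIdealTop (Ideal.span {(γ 4 K).symm (X j.succ + C a)}))).comap φ₁ =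
              ofIdealTop (Ideal.span {(γ 4 K).symm (X j.succ + C (a + h))}) := by
            rw [hφ₁, Scheme.IdealSheafData.comap_comp, hCf, strictTransform_hyperplane_j_height_of_ne hτ₁ ha]
            exact comap_specMap_principal_of_fix Θ (by rw [map_add, hs j, show Θ (C (a + h)) = C (a + h) from Θ.commutes _])
          rw [e6, g6 (a + h)]
          have hiff : (-(a + h)) ∈ hs'.map (fun h' => h' - h) ↔ -a ∈ hs' := by
            rw [List.mem_map]
            constructor
            · rintro ⟨h', hh', e⟩
              have : h' = -a := by linear_combination e
              exact this ▸ hh'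
            · intro hm
              exact ⟨-a, hm, by ring⟩
          have hah : -a ≠ h := fun e => ha (by rw [← e, add_neg_cancel])
          by_cases hm : -a ∈ hs'
          · rw [if_pos (hiff.mpr hm), if_pos (List.mem_cons.mpr (Or.inr hm))]
          · rw [if_neg (fun hm' => hm (hiff.mp hm')), if_neg (fun hm' => (List.mem_cons.mp hm').elim hah hm), add_assoc, add_sub_cancel]
      · -- (7) near members
        have e7 : (strictTransformIdeal τ₁ (Cf h) (ofIdealTop (Ideal.span {(γ 4 K).symm (X t.succ + C 0)}))).comap φ₁ =
            ofIdealTop (Ideal.span {(γ 4 K).symm (X t.succ + C 0)}) := by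
          rw [hφ₁, Scheme.IdealSheafData.comap_comp, hCf, strictTransform_hyperplane_centreVar_height hτ₁ ht hjT]
          exact comap_specMap_principal_of_fix Θ (by rw [map_add, hs t, show Θ (C (0 : K)) = C 0 from Θ.commutes _])
        rw [IsBlowup.strictTransformIdeal_comp_of_disjoint hτ₂ hdisj, Scheme.IdealSheafData.comap_comp, ← strictTransformIdeal_model φ₁, hX, e7]
        exact g7 t ht
      · -- (8) transversal members
        have e8 : (strictTransformIdeal τ₁ (Cf h) (ofIdealTop (Ideal.span {(γ 4 K).symm (X i.succ + C a)}))).comap φ₁ =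
            ofIdealTop (Ideal.span {(γ 4 K).symm (X i.succ + C a)}) := by
          rw [hφ₁, Scheme.IdealSheafData.comap_comp, hCf, strictTransform_hyperplane_transversal_height hτ₁ hiT hij a]
          exact comap_specMap_principal_of_fix Θ (by rw [map_add, hs i, show Θ (C a) = C a from Θ.commutes _])
        rw [IsBlowup.strictTransformIdeal_comp_of_disjoint hτ₂ hdisj, Scheme.IdealSheafData.comap_comp, ← strictTransformIdeal_model φ₁, hX, e8]
        exact g8 i hiT hij a

/-- **THE POST-REPAIR READING AT ANY FINITE NUMBER OF HEIGHTS** (chart model; see the module docstring for the eight clauses). -/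
theorem farRepair_chart_reading_heights [PerfectRing K p] [DecidableEq K] (hjT : j ∉ T) :
    ∀ (hs : List K), hs ≠ [] → hs.Nodup → ∀ (F : MvPolynomial (Fin 4) K), (p : ℕ∞) ≤ CentreBlowup.ordAlong T F →
    ∀ {V' : Scheme.{0}} {τ : V' ⟶ P 4 K},
    IsBlowup τ (hs.map fun h => (AffineCoordBlowup.𝓘Λ 4 K (insert 0 (Fin.succ '' ((insert j T : Finset (Fin 4)) : Set (Fin 4))))).comap
      (Spec.map (CommRingCat.ofHom ((AffinePointBlowup.translateEquiv (n := 4) (Pi.single j.succ (-h)) : A 4 K ≃ₐ[K] A 4 K) :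
        A 4 K →+* A 4 K)))).prod →
    let Cm := (hs.map fun h => (AffineCoordBlowup.𝓘Λ 4 K (insert 0 (Fin.succ '' ((insert j T : Finset (Fin 4)) : Set (Fin 4))))).comap
      (Spec.map (CommRingCat.ofHom ((AffinePointBlowup.translateEquiv (n := 4) (Pi.single j.succ (-h)) : A 4 K ≃ₐ[K] A 4 K) :
        A 4 K →+* A 4 K)))).prod
    let out := hs.foldl (fun (acc : K × MvPolynomial (Fin 4) K) (h : K) =>
      (h, (CentreBlowup.step p (insert j T) j 0 ⟨PointBlowup.translate (Pi.single j (h - acc.1)) acc.2, 0, ∅⟩).F)) (0, F)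
    ∃ (φ : P 4 K ⟶ V') (_ : IsOpenImmersion φ),
      (strictTransformIdeal τ Cm (AffineCoordBlowup.𝓘Λ 4 K (insert 0 (Fin.succ '' (T : Set (Fin 4)))))).comap φ =
          AffineCoordBlowup.𝓘Λ 4 K (insert 0 (Fin.succ '' (T : Set (Fin 4)))) ∧
        ((strictTransformIdeal τ Cm (AffineCoordBlowup.𝓘Λ 4 K (insert 0 (Fin.succ '' (T : Set (Fin 4)))))).support : Set V') ⊆
          Set.range φ ∧
        (controlledTransform τ Cm (hypSheaf p F) p).comap φ = hypSheaf p out.2 ∧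
        (p : ℕ∞) ≤ CentreBlowup.ordAlong T out.2 ∧
        (Cm.comap τ).comap φ = (hs.map fun h => ofIdealTop (Ideal.span {(γ 4 K).symm (X j.succ + C (out.1 - h))})).prod ∧
        (∀ a : K, (strictTransformIdeal τ Cm (ofIdealTop (Ideal.span {(γ 4 K).symm (X j.succ + C a)}))).comap φ =
          if -a ∈ hs then ⊤ else ofIdealTop (Ideal.span {(γ 4 K).symm (X j.succ + C (a + out.1))})) ∧
        (∀ t ∈ T, (strictTransformIdeal τ Cm (ofIdealTop (Ideal.span {(γ 4 K).symm (X t.succ + C 0)}))).comap φ =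
          ofIdealTop (Ideal.span {(γ 4 K).symm (X t.succ + C 0)})) ∧
        (∀ i ∉ T, i ≠ j → ∀ a : K, (strictTransformIdeal τ Cm (ofIdealTop (Ideal.span {(γ 4 K).symm (X i.succ + C a)}))).comap φ =
          ofIdealTop (Ideal.span {(γ 4 K).symm (X i.succ + C a)})) := by
  intro hs
  exact farRepair_chart_reading_heights_aux hjT hs.length hs rfl

end Heights

end ChartDictionary

end Summit.ResolutionOfSingularities.ResolutionOfSingularities.Theorems.PIDim4

end
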